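import Literature.Topology.FourManifolds.HomotopyBallSliceSphereProofs
import Literature.Topology.FourManifolds.ImmersionCriterion
import Literature.Topology.FourManifolds.HomotopyS4CompactProofs
import Literature.Topology.FourManifolds.MMSWRasmussenFacts
import Summits.SmoothPoincare4.SmoothPoincare4.Theorems.DottedCircleRasmussenDcrGapStubDepthZeroImport

/-!
# Crux `DcrGap` (stmt-SmoothPoincare4-16128), line `Sketch` — rung `0` of the crux IS the FGMW waypoint

Helper `helper_rungZeroIff` of the line (registered on the crux item): the `k = 0` slice of the
ONE-HANDLE SLICE GAP `DottedCircleRasmussen.DcrGap` — a model knot on the ellipsoid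
`∂D_0 = {|z|²/40² + |w|² = 1}` that is complement-slice in some homotopy 4-sphere but in no
`N ≅ S⁴` — is EQUIVALENT to the waypoint `ZeroSurgeryExotic.ZseHsliceNotSlice` (an `S³`-knot slice in
a homotopy 4-ball but not in `B⁴`, item stmt-SmoothPoincare4-0520). So the dotted-circle route has NO
surplus over Freedman–Gompf–Morrison–Walker at rung `0`; whatever it buys lives at `k ≥ 1`
(card `filling-disc-depth`: "depth 0 = FGMW"). Direction `←` re-runs the landed stub
`stub_depthZeroImport` at `k = 0` (its stretch lemmas are reused); direction `→` normalises the model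
knot back to the round `S³` by `A⁻¹`, `A(z, w) = (40 z, w)`, packages it as a `Knot` (injective
immersion of the compact `S¹`: `isSmoothEmbedding_of_injective_of_injective_mfderiv`), reads the
complement datum as a homotopy-ball datum (a homotopy 4-sphere is compact:
`compactSpace_of_homotopyEquiv_sphere_four_holds`), and turns a slice disc in `B⁴` into a datum in
`S⁴` forbidden by the no-disc clause (`Knot.IsSliceDisc.isSliceDiscIn_sphere`).
No definitions, no named facts, no `sorry`.

References: Freedman–Gompf–Morrison–Walker, Quantum Topol. 1 (2010), §1
[FreedmanGompfMorrisonWalker2010]; Manolescu–Piccirillo, J. Lond. Math. Soc. 108 (2023), §2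
[ManolescuPiccirillo2023]; Palais, Proc. AMS 11 (1960), Thm. B [Palais1960].
-/

noncomputable section

set_option linter.dupNamespace false

open scoped Manifold ContDiff Topology
open Function Set
open Literature.Topology.FourManifolds

namespace Summit.SmoothPoincare4.SmoothPoincare4.Theorems.DcrGap.Sketch

/-- **A model knot on the ellipsoid `∂D_0`, pulled back by the stretch `A`, is a knot in `S³`.**
For `A(z, w) = (40 z, w)` and a model knot `K₀ ⊂ ∂D_0` (`MMSW.IsModelKnot 0 K₀`), the loop
`A⁻¹ ∘ K₀` takes values in the unit sphere and is a smooth embedding `S¹ ↪ S³` there (an injective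
immersion of the compact `S¹`); the resulting `Knot` has underlying map `A⁻¹ ∘ K₀`. [folklore] -/
theorem rungZero_exists_knot {A : EuclideanSpace ℝ (Fin 4) ≃L[ℝ] EuclideanSpace ℝ (Fin 4)}
    (h0 : ∀ x, A x 0 = 40 * x 0) (h1 : ∀ x, A x 1 = 40 * x 1) (h2 : ∀ x, A x 2 = x 2)
    (h3 : ∀ x, A x 3 = x 3)
    {K₀ : (Metric.sphere (0 : EuclideanSpace ℝ (Fin 2)) 1) → EuclideanSpace ℝ (Fin 4)}
    (hK₀ : MMSW.IsModelKnot 0 K₀) :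
    ∃ K : Knot, ∀ t, ((K t : Metric.sphere (0 : EuclideanSpace ℝ (Fin 4)) 1) :
      EuclideanSpace ℝ (Fin 4)) = A.symm (K₀ t) := by
  haveI : Fact (Module.finrank ℝ (EuclideanSpace ℝ (Fin 4)) = 3 + 1) := ⟨finrank_euclideanSpace_fin⟩
  have hn : ((⊤ : ℕ∞) : WithTop ℕ∞) ≠ 0 := by simp
  obtain ⟨hs, hinj, hd, hmem⟩ := hK₀
  -- the pulled-back loop takes values in the unit sphere
  set κ : (Metric.sphere (0 : EuclideanSpace ℝ (Fin 2)) 1) → EuclideanSpace ℝ (Fin 4) :=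
    fun t => A.symm (K₀ t) with hκ
  have hκmem : ∀ t, κ t ∈ Metric.sphere (0 : EuclideanSpace ℝ (Fin 4)) 1 := fun t => by
    have hlev := (hmem t).2
    have hK : K₀ t = A (κ t) := (A.apply_symm_apply (K₀ t)).symm
    rw [hK] at hlev
    unfold MMSW.levelFun at hlev
    simp only [Finset.univ_eq_empty, Finset.sum_empty, add_zero, CharP.cast_eq_zero, zero_add,
      mul_one, h0, h1, h2, h3] at hlev
    have hsq : ‖κ t‖ ^ 2 = 1 := by
      rw [EuclideanSpace.norm_sq_eq]
      simp only [Real.norm_eq_abs, sq_abs, Fin.sum_univ_four]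
      nlinarith [hlev]
    rw [mem_sphere_zero_iff_norm]
    exact (pow_eq_one_iff_of_nonneg (norm_nonneg _) two_ne_zero).1 hsq
  -- smoothness, injectivity, immersivity of `κ`
  have hAs : ContMDiff 𝓘(ℝ, EuclideanSpace ℝ (Fin 4)) 𝓘(ℝ, EuclideanSpace ℝ (Fin 4))
      ((⊤ : ℕ∞) : WithTop ℕ∞) A.symm :=
    (A.symm : EuclideanSpace ℝ (Fin 4) →L[ℝ] EuclideanSpace ℝ (Fin 4)).contDiff.contMDiff
  have hκs : ContMDiff (𝓡 1) 𝓘(ℝ, EuclideanSpace ℝ (Fin 4)) ((⊤ : ℕ∞) : WithTop ℕ∞) κ :=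
    hAs.comp hs
  have hκi : Injective κ := A.symm.injective.comp hinj
  have hκd : ∀ t, Injective (mfderiv (𝓡 1) 𝓘(ℝ, EuclideanSpace ℝ (Fin 4)) κ t) := fun t => by
    have hd1 : MDifferentiableAt (𝓡 1) 𝓘(ℝ, EuclideanSpace ℝ (Fin 4)) K₀ t :=
      (hs t).mdifferentiableAt hn
    have hd2 : MDifferentiableAt 𝓘(ℝ, EuclideanSpace ℝ (Fin 4)) 𝓘(ℝ, EuclideanSpace ℝ (Fin 4))
        A.symm (K₀ t) := (hAs (K₀ t)).mdifferentiableAt hn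
    have hmA : mfderiv 𝓘(ℝ, EuclideanSpace ℝ (Fin 4)) 𝓘(ℝ, EuclideanSpace ℝ (Fin 4)) A.symm (K₀ t) =
        (A.symm : EuclideanSpace ℝ (Fin 4) →L[ℝ] EuclideanSpace ℝ (Fin 4)) := by
      rw [mfderiv_eq_fderiv]; exact A.symm.fderiv
    rw [hκ, show (fun t => A.symm (K₀ t)) = A.symm ∘ K₀ from rfl, mfderiv_comp t hd2 hd1, hmA]
    exact A.symm.injective.comp (hd t)
  -- the loop as a map into `S³`
  set Kc : (Metric.sphere (0 : EuclideanSpace ℝ (Fin 2)) 1) →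
      (Metric.sphere (0 : EuclideanSpace ℝ (Fin 4)) 1) := Set.codRestrict κ _ hκmem with hKc
  have hKcs : ContMDiff (𝓡 1) (𝓡 3) ((⊤ : ℕ∞) : WithTop ℕ∞) Kc := hκs.codRestrict_sphere hκmem
  have hKci : Injective Kc := (Set.injective_codRestrict hκmem).2 hκi
  have hval : (Subtype.val : (Metric.sphere (0 : EuclideanSpace ℝ (Fin 4)) 1) →
      EuclideanSpace ℝ (Fin 4)) ∘ Kc = κ := rfl
  have hKcd : ∀ t, Injective (mfderiv (𝓡 1) (𝓡 3) Kc t) := fun t => by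
    have hd1 : MDifferentiableAt (𝓡 1) (𝓡 3) Kc t := (hKcs t).mdifferentiableAt hn
    have hd2 : MDifferentiableAt (𝓡 3) 𝓘(ℝ, EuclideanSpace ℝ (Fin 4))
        (Subtype.val : (Metric.sphere (0 : EuclideanSpace ℝ (Fin 4)) 1) → EuclideanSpace ℝ (Fin 4))
        (Kc t) :=
      ((contMDiff_coe_sphere (E := EuclideanSpace ℝ (Fin 4)) (n := 3)) (Kc t)).mdifferentiableAt hn
    have h := hκd t
    rw [← hval, mfderiv_comp t hd2 hd1] at h
    exact (show Injective (⇑(mfderiv (𝓡 3) 𝓘(ℝ, EuclideanSpace ℝ (Fin 4))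
      (Subtype.val : (Metric.sphere (0 : EuclideanSpace ℝ (Fin 4)) 1) → EuclideanSpace ℝ (Fin 4))
      (Kc t)) ∘ ⇑(mfderiv (𝓡 1) (𝓡 3) Kc t)) from h).of_comp
  have h1 : (1 : WithTop ℕ∞) ≤ ((⊤ : ℕ∞) : WithTop ℕ∞) := by exact_mod_cast le_top
  exact ⟨⟨Kc, isSmoothEmbedding_of_injective_of_injective_mfderiv hKcs h1 hKci hKcd⟩,
    fun t => rfl⟩

/-- The model handlebody `D_0` (no holes) is, by definition, the literal sublevel set
`{(x₀²+x₁²)/(40·1)² + 0 + x₂² + x₃² ≤ 1}` used by the stretch lemmas. [folklore] -/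
theorem rungZero_modelHandlebody_eq :
    MMSW.modelHandlebody 0 = {x : EuclideanSpace ℝ (Fin 4) | (∀ j : Fin 0, (1 : ℝ) ≤ (x 0 - 4 * (((j : ℕ) : ℝ) + 1)) ^ 2 + (x 1) ^ 2) ∧ ((x 0) ^ 2 + (x 1) ^ 2) / (40 * ((((0 : ℕ) : ℕ) : ℝ) + 1)) ^ 2 + (∑ j : Fin 0, 1 / ((x 0 - 4 * (((j : ℕ) : ℝ) + 1)) ^ 2 + (x 1) ^ 2)) + (x 2) ^ 2 + (x 3) ^ 2 ≤ 1} :=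
  rfl

/-- **Helper `helper_rungZeroIff` (line `Sketch`): rung `0` of the crux is exactly the FGMW
waypoint.** The `k = 0` slice of `DcrGap` (in the Literature vocabulary `MMSW.IsModelKnot 0`,
`MMSW.IsSliceDiscInComplement 0`, definitionally the route's binders) holds iff some `S³`-knot is
slice in a homotopy 4-ball but not in `B⁴` (`ZseHsliceNotSlice`). `→`: pull the model knot back to
`S³` by `A⁻¹` (`rungZero_exists_knot`), the datum `(e, f)` to the homotopy-ball datum `(e ∘ A, f)`
(the homotopy sphere is compact), and a slice disc in `B⁴` would give, pushed into `S⁴`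
(`Knot.IsSliceDisc.isSliceDiscIn_sphere`) and re-stretched, a datum the no-disc clause forbids at
`N := S⁴`. `←`: the construction of `stub_depthZeroImport` at `k = 0`.
[cite: FreedmanGompfMorrisonWalker2010, §1] [cite: ManolescuPiccirillo2023, §2] [cite: Palais1960, Thm. B] -/
theorem helper_rungZeroIff : (∃ K : (Metric.sphere (0 : EuclideanSpace ℝ (Fin 2)) 1) → EuclideanSpace ℝ (Fin 4), Literature.Topology.FourManifolds.MMSW.IsModelKnot 0 K ∧ (∃ (M : Type) (_ : TopologicalSpace M) (_ : T2Space M) (_ : SecondCountableTopology M) (_ : ChartedSpace (EuclideanSpace ℝ (Fin 4)) M) (_ : IsManifold (𝓡 4) ((⊤ : ℕ∞) : WithTop ℕ∞) M), Nonempty (ContinuousMap.HomotopyEquiv M (Metric.sphere (0 : EuclideanSpace ℝ (Fin 5)) 1)) ∧ ∃ (e : EuclideanSpace ℝ (Fin 4) → M) (f : EuclideanSpace ℝ (Fin 2) → M), Literature.Topology.FourManifolds.MMSW.IsSliceDiscInComplement 0 K M e f) ∧ ∀ (N : Type) [TopologicalSpace N] [T2Space N] [SecondCountableTopology N] [ChartedSpace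 (EuclideanSpace ℝ (Fin 4)) N] [IsManifold (𝓡 4) ((⊤ : ℕ∞) : WithTop ℕ∞) N], Nonempty (Diffeomorph (𝓡 4) (𝓡 4) N (Metric.sphere (0 : EuclideanSpace ℝ (Fin 5)) 1) ((⊤ : ℕ∞) : WithTop ℕ∞)) → ∀ (e' : EuclideanSpace ℝ (Fin 4) → N) (f' : EuclideanSpace ℝ (Fin 2) → N), ¬ Literature.Topology.FourManifolds.MMSW.IsSliceDiscInComplement 0 K N e' f') ↔ Summit.SmoothPoincare4.SmoothPoincare4.Theses.ZeroSurgeryExotic.ZseHsliceNotSlice := by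
  haveI : Fact (Module.finrank ℝ (EuclideanSpace ℝ (Fin 5)) = 4 + 1) := ⟨finrank_euclideanSpace_fin⟩
  obtain ⟨A, hA0, hA1, hA2, hA3⟩ := depthZero_exists_stretch
  constructor
  · rintro ⟨K₀, hK₀, ⟨M, i1, i2, i3, i4, i5, ⟨hM⟩, e, f, hef⟩, hno⟩
    obtain ⟨K, hK⟩ := rungZero_exists_knot hA0 hA1 hA2 hA3 hK₀
    haveI : CompactSpace M := compactSpace_of_homotopyEquiv_sphere_four_holds M hM
    obtain ⟨he, hf, hinj, hmf, hout, hbdry⟩ := hef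
    refine ⟨K, ⟨M, i1, i2, i3, i4, i5, ‹CompactSpace M›, ⟨hM⟩, e ∘ A, f, ?_, hf, hinj, hmf, ?_, ?_⟩,
      ?_⟩
    · have : e ∘ A = e ∘ A.toDiffeomorph := by ext x; simp
      rw [this]
      exact he.comp_diffeomorph A.toDiffeomorph
    · intro x hx hmem
      rw [Set.image_comp, depthZero_image_stretch_closedBall hA0 hA1 hA2 hA3] at hmem
      rw [rungZero_modelHandlebody_eq] at hout
      exact hout x hx hmem
    · intro t
      rw [comp_apply, hK t, A.apply_symm_apply]
      exact hbdry t
    · rintro ⟨g, hg⟩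
      set a : Metric.sphere (0 : EuclideanSpace ℝ (Fin 5)) 1 := ⟨EuclideanSpace.single 0 1, by simp⟩
      obtain ⟨he1, hf1, hinj1, hmf1, hout1, hbdry1⟩ := hg.isSliceDiscIn_sphere a
      refine hno (Metric.sphere (0 : EuclideanSpace ℝ (Fin 5)) 1) ⟨Diffeomorph.refl _ _ _⟩
        ((chartAt (EuclideanSpace ℝ (Fin 4)) a).symm ∘ A.symm) _ ⟨?_, hf1, hinj1, hmf1, ?_, ?_⟩
      · have : ((chartAt (EuclideanSpace ℝ (Fin 4)) a).symm : EuclideanSpace ℝ (Fin 4) → _) ∘ A.symm =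
            (chartAt (EuclideanSpace ℝ (Fin 4)) a).symm ∘ A.symm.toDiffeomorph := by ext x; simp
        rw [this]
        exact he1.comp_diffeomorph A.symm.toDiffeomorph
      · intro x hx hmem
        rw [rungZero_modelHandlebody_eq, Set.image_comp,
          depthZero_image_symm_model hA0 hA1 hA2 hA3] at hmem
        exact hout1 x hx hmem
      · intro t
        rw [comp_apply, ← hK t]
        exact hbdry1 t
  · rintro ⟨K, ⟨M, i1, i2, i3, i4, i5, i6, hM, e, f, hef⟩, hns⟩
    obtain ⟨he, hf, hinj, hmf, hout, hbdry⟩ := hef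
    obtain ⟨hK1, hK2, hK3, hK4⟩ := depthZero_modelKnot hA0 hA1 hA2 hA3 K
    refine ⟨fun t => A ((K t : Metric.sphere (0 : EuclideanSpace ℝ (Fin 4)) 1) :
        EuclideanSpace ℝ (Fin 4)), ⟨hK1, hK2, hK3, hK4⟩, ⟨M, i1, i2, i3, i4, i5, hM,
        e ∘ A.symm, f, ?_, hf, hinj, hmf, ?_, ?_⟩, ?_⟩
    · have : e ∘ A.symm = e ∘ A.symm.toDiffeomorph := by ext x; simp
      rw [this]
      exact he.comp_diffeomorph A.symm.toDiffeomorph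
    · intro x hx hmem
      rw [rungZero_modelHandlebody_eq, Set.image_comp, depthZero_image_symm_model hA0 hA1 hA2 hA3]
        at hmem
      exact hout x hx hmem
    · intro t
      simp only [comp_apply, ContinuousLinearEquiv.symm_apply_apply]
      exact hbdry t
    · intro N _ _ _ _ _ hN e' f' h'
      obtain ⟨Φ⟩ := hN
      obtain ⟨he', hf', hinj', hmf', hout', hbdry'⟩ := h'
      have hslice : K.IsSliceDiscIn N (e' ∘ A) f' := by
        refine ⟨?_, hf', hinj', hmf', fun x hx hmem => ?_, fun t => hbdry' t⟩
        · have : e' ∘ A = e' ∘ A.toDiffeomorph := by ext x; simp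
          rw [this]
          exact he'.comp_diffeomorph A.toDiffeomorph
        · rw [Set.image_comp, depthZero_image_stretch_closedBall hA0 hA1 hA2 hA3] at hmem
          rw [rungZero_modelHandlebody_eq] at hout'
          exact hout' x hx hmem
      apply hns
      have h'' := hslice.diffeomorph_comp Φ
      obtain ⟨U, c, hc₁, hc₂⟩ :=
        Knot.palais_ballComplement_sphere_four_holds (Φ ∘ (e' ∘ A)) h''.isSmoothEmbedding
      obtain ⟨g, hg⟩ := h''.exists_isProperDisc c hc₁ hc₂
      exact Knot.isSmoothlySlice_of_isProperDisc_holds K g hg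

end Summit.SmoothPoincare4.SmoothPoincare4.Theorems.DcrGap.Sketch

end
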